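import Summits.QuantumFields.BalabanUV.Gaps.CapTailLimitNecessary

/-!
# Gaps / CapTailSlopeSandwich — the constants of [I] (0.31) SANDWICH the one-loop limit: `β·log L ≤ β⁰_∞ ≤ β′·log L` for any constants that
# realise (0.31) on a box where the remainder is bounded, given the every-slope currency and convergence of `β⁰` (cell pub-balaban-gaps, seat g1-p3
# gen 3, CAP+tail «split ∕ weakening» charge; fourth file of the necessity series `CapSignsNecessary` ∕ `CapFloorNotNecessary` ∕ `CapTailLimitNecessary`)

HONEST FRAMING (cell rule, page 1 of everything): bookkeeping over the β sub-cell's hypothesis carriers; NOTHING of Bałaban's is asserted beyond print;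
[Balaban1987RG1] Thm 2 is UNPROVED IN PRINT — here its (0.31) clause for given constants is a HYPOTHESIS (`hK` below, the output shape of
`CapSignsNecessary.runs_of_thm2Printed`); 0 binders discharged; NOT `BetaPertH`, NOT the continuum limit, NOT Clay.  HONEST DEPENDENCY (b2b cell,
verbatim): «continuum YM on T⁴ ⇐ BetaPertH ∧ nine spine estimates (0/9 proved); BetaPertH ⇐ (D1) ∧ (D4) ∧ CAP+tail; G-an2-4 gates asym, D1 and NE2/3/4.»

CONTENT.  §1 `beta0_windowSum_le_of_run` — the UPPER mirror of `CapSignsNecessary.beta0_windowSum_ge_of_run`: along a run obeying BOTH halves of (0.31)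
(lower slope `c > 0`, upper slope `c′`), `Σ_{j∈[k,K)} β⁰_{j+1} ≤ (c′ + s)(K−k) + R·N₀` (far prefixes in the small box by the LOWER half, as before);
`lim_le_of_windowSum_upper_tendsto` (Cesàro, mirror of `CapTailLimitNecessary.le_lim_of_windowSum_lower_tendsto`).
§2 **`slope_sandwich_binf_of_runs`**: if constants `0 < b`, `β′` realise (0.31) for a split's forward runs on a box `]0,γ]` where `|β¹| ≤ R`, for every
lattice `K` (the clause of `B12.Thm2Printed` at fixed `m, γ, g`, with the history recursion), and the split has the every-slope currency and CONVERGENT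
one-loop coefficients `β⁰_{k+1} → β⁰_∞`, then `b·log L ≤ β⁰_∞ ≤ β′·log L`.  So the printed running constants are not free: per `log L` they must
enclose the one-loop limit — the necessity counterpart of the sufficiency constants (floor∕(2 log L)) of `CapSignsConstRoad.thm2Printed_of_beta0Floor_everySlope`.
§3 `thm2Printed_constants_sandwich` — packaged over `B12.Thm2Printed C L`: for every `m`, on every small box and admissible `g`, the construction's
(0.31) holds with SOME constants, and EVERY such pair realising it there (with the recursion) sandwiches `β⁰_∞/log L`.
All [folklore] real-sequence bookkeeping; 0 sorry; 0 def; imports `Gaps.CapTailLimitNecessary`; restates nothing.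
-/

namespace Summit.QuantumFields.BalabanUV.Gaps.CapTailSlopeSandwich

open Literature.MathematicalPhysics.QuantumFieldTheory.Balaban1983to89
open Literature.MathematicalPhysics.QuantumFieldTheory.Balaban1983to89.FlowStep
open Literature.MathematicalPhysics.QuantumFieldTheory.Balaban1983to89.FlowStepRuns
open Literature.MathematicalPhysics.QuantumFieldTheory.Balaban1983to89.DagBinding
open Literature.MathematicalPhysics.QuantumFieldTheory.Balaban1983to89.Beta.RemainderChain (RemainderConst)
open Summit.QuantumFields.BalabanUV.Gaps.CapSignsConstRoad (EverySlope)
open Summit.QuantumFields.BalabanUV.Gaps.CapSignsNecessary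
open Summit.QuantumFields.BalabanUV.Gaps.CapTailLimitNecessary
open Filter
open scoped Topology

noncomputable section

variable {β : HBeta}

/-! ## §1 The upper mirror of the window bookkeeping -/

/-- Along a solution of the history recursion in `]0,γ]` up to `K`, ending at `g_K > 0`, obeying the LOWER half of (0.31) with slope `c > 0` and the
UPPER half with slope `c′`, with `|β¹| ≤ R` on `]0,γ]`-histories and `≤ s` on the small box `]0,γₛ]` (`1 ≤ c·N₀·γₛ²`):
`Σ_{j∈[k,K)} β⁰_{j+1} ≤ (c′ + s)(K−k) + R·N₀`. [folklore] -/
theorem beta0_windowSum_le_of_run (S : B12Beta.OneLoopSplit β) {K k N₀ : ℕ} {g : ℕ → ℝ} {gK c c' γ γs s R : ℝ}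
    (hc : 0 < c) (hrg : RGEqH K β g) (hend : g K = gK) (hgK : 0 < gK) (hI : ∀ j, j ≤ K → 0 < g j ∧ g j ≤ γ)
    (hR : RemainderConst S γ R) (hs : RemainderConst S γs s) (hγs : 0 < γs) (hN₀ : 1 ≤ c * N₀ * γs ^ 2)
    (hlow : ∀ j, j ≤ K → 1 / gK ^ 2 + c * ((K : ℝ) - j) ≤ 1 / (g j) ^ 2)
    (hup : ∀ j, j ≤ K → 1 / (g j) ^ 2 ≤ 1 / gK ^ 2 + c' * ((K : ℝ) - j)) (hk : k ≤ K) :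
    ∑ j ∈ Finset.Ico k K, S.β0 j ≤ (c' + s) * ((K : ℝ) - k) + R * N₀ := by
  have hgK2 : 0 < 1 / gK ^ 2 := by positivity
  have ht := inv_sq_telescopeH hrg hk le_rfl
  rw [hend] at ht
  have hwin : ∑ j ∈ Finset.Ico k K, β j (prefixOf g j) ≤ c' * ((K : ℝ) - k) := by linarith [hup k hk]
  set M : ℕ := max k (K - N₀) with hM
  have hkM : k ≤ M := le_max_left _ _
  have hMK : M ≤ K := max_le hk (Nat.sub_le K N₀)
  have hfar : ∀ j ∈ Finset.Ico k M, S.β0 j - s ≤ β j (prefixOf g j) := by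
    intro j hj
    obtain ⟨hkj, hjM⟩ := Finset.mem_Ico.mp hj
    have hjK' : j < K - N₀ := by
      rcases lt_max_iff.mp (hM ▸ hjM) with h | h
      · exact absurd hkj (not_le.mpr h)
      · exact h
    have hp : prefixOf g j ∈ B12Beta.HistBox γs j := by
      intro i
      have hiK : (i : ℕ) ≤ K := by omega
      have hgi := (hI i hiK).1
      refine ⟨by simpa [prefixOf_apply] using hgi, ?_⟩
      have hdist : (N₀ : ℝ) ≤ (K : ℝ) - (i : ℕ) := by
        have h1 : (i : ℕ) + N₀ < K := by omega
        have h2 : (((i : ℕ) + N₀ : ℕ) : ℝ) ≤ K := by exact_mod_cast h1.le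
        push_cast at h2
        linarith
      have h1 : c * N₀ ≤ 1 / (g i) ^ 2 := by
        have := hlow i hiK
        nlinarith [mul_le_mul_of_nonneg_left hdist hc.le]
      have hg2 : 0 < (g i) ^ 2 := by positivity
      have h2 : c * N₀ * (g i) ^ 2 ≤ 1 := by rwa [← le_div_iff₀ hg2]
      have h3 : (g i) ^ 2 ≤ γs ^ 2 := by nlinarith [hN₀, h2, hg2.le, sq_nonneg γs]
      have h4 : g i ≤ γs := (pow_le_pow_iff_left₀ hgi.le hγs.le two_ne_zero).mp h3
      simpa [prefixOf_apply] using h4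
    have h1 := (abs_le.mp (hs j _ hp)).1
    rw [S.split j]
    linarith
  have hnear : ∀ j ∈ Finset.Ico M K, S.β0 j - R ≤ β j (prefixOf g j) := by
    intro j hj
    have hjK : j ≤ K := (Finset.mem_Ico.mp hj).2.le
    have hp : prefixOf g j ∈ B12Beta.HistBox γ j := fun i => hI i (by omega)
    have h1 := (abs_le.mp (hR j _ hp)).1
    rw [S.split j]
    linarith
  have hs0 : 0 ≤ s := by
    have := hs 0 (fun _ => γs) (fun _ => ⟨hγs, le_rfl⟩)
    exact (abs_nonneg _).trans this
  have hR0 : 0 ≤ R := by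
    have hγ0 : 0 < γ := (hI 0 (Nat.zero_le K)).1.trans_le (hI 0 (Nat.zero_le K)).2
    have := hR 0 (fun _ => γ) (fun _ => ⟨hγ0, le_rfl⟩)
    exact (abs_nonneg _).trans this
  have hs1 := Finset.sum_le_sum hfar
  have hs2 := Finset.sum_le_sum hnear
  rw [Finset.sum_sub_distrib, Finset.sum_const, Nat.card_Ico, nsmul_eq_mul] at hs1 hs2
  have hc1 : ((M - k : ℕ) : ℝ) ≤ (K : ℝ) - k := by
    rw [Nat.cast_sub hkM]
    have : (M : ℝ) ≤ K := by exact_mod_cast hMK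
    linarith
  have hc2 : ((K - M : ℕ) : ℝ) ≤ N₀ := by exact_mod_cast (show K - M ≤ N₀ by omega)
  have hsplitβ := Finset.sum_Ico_consecutive (fun j => β j (prefixOf g j)) hkM hMK
  have hsplit0 := Finset.sum_Ico_consecutive S.β0 hkM hMK
  nlinarith [hs1, hs2, hwin, hsplitβ, hsplit0, mul_le_mul_of_nonneg_right hc1 hs0, mul_le_mul_of_nonneg_right hc2 hR0]

/-- Window sums `≤ c·n + A` of a CONVERGENT sequence force `lim ≤ c` (Cesàro; mirror of `CapTailLimitNecessary.le_lim_of_windowSum_lower_tendsto`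
applied to `−b`). [folklore] -/
theorem lim_le_of_windowSum_upper_tendsto {b : ℕ → ℝ} {c A binf : ℝ}
    (hw : ∀ k n : ℕ, ∑ j ∈ Finset.Ico k (k + n), b j ≤ c * n + A) (hlim : Tendsto b atTop (𝓝 binf)) : binf ≤ c := by
  have hw' : ∀ k n : ℕ, (-c) * n - A ≤ ∑ j ∈ Finset.Ico k (k + n), (-b j) := by
    intro k n
    rw [Finset.sum_neg_distrib]
    linarith [hw k n]
  have := le_lim_of_windowSum_lower_tendsto hw' hlim.neg
  linarith

/-! ## §2 The sandwich -/

/-- **THE (0.31) CONSTANTS SANDWICH THE ONE-LOOP LIMIT.**  Let a split `S` of `β` have a remainder bounded by `R` on `]0,γ]`-histories and the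
every-slope currency (`EverySlope S γc`), and CONVERGENT one-loop coefficients `β⁰_{k+1} → β⁰_∞`.  If constants `b > 0` and `β′` realise the two-sided
(0.31) with the history recursion for a construction's runs in `]0,γ]` ending at `g > 0`, for EVERY lattice `K` (the inner clause of
`B12.Thm2Printed C L` at fixed `m, γ, g` — `CapSignsNecessary.runs_of_thm2Printed`), and `L > 1`, then
`b·log L ≤ β⁰_∞ ≤ β′·log L`.  Proof: for every `s > 0` the window bookkeeping (§1 and `CapSignsNecessary.beta0_windowSum_ge_of_run` with the small
box of `EverySlope` at `s`) gives `(b log L − s)·n − O(1) ≤ Σ_{[k,k+n)} β⁰ ≤ (β′ log L + s)·n + O(1)`; Cesàro and `s → 0`.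
[cite: Balaban1987RG1, Thm 2 (0.31) p.259] -/
theorem slope_sandwich_binf_of_runs (S : B12Beta.OneLoopSplit β) {C : B12.Construction} {m : ℕ} {γ γc g b β' L R binf : ℝ}
    (hg : 0 < g) (hb : 0 < b) (hL : 1 < L) (hR : RemainderConst S γ R) (hrem : EverySlope S γc)
    (hlim : Tendsto S.β0 atTop (𝓝 binf))
    (hK : ∀ K : ℕ, ∃ g0 : ℝ, (C ⟨K, m, g0⟩).flow.InInterval γ K ∧ (C ⟨K, m, g0⟩).flow.g K = g ∧
      RGEqH K β (C ⟨K, m, g0⟩).flow.g ∧ ∀ k, k ≤ K →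
        1 / g ^ 2 + b * (((K : ℝ) - k) * Real.log L) ≤ 1 / ((C ⟨K, m, g0⟩).flow.g k) ^ 2 ∧
        1 / ((C ⟨K, m, g0⟩).flow.g k) ^ 2 ≤ 1 / g ^ 2 + β' * (((K : ℝ) - k) * Real.log L)) :
    b * Real.log L ≤ binf ∧ binf ≤ β' * Real.log L := by
  have hlog : 0 < Real.log L := Real.log_pos hL
  set c : ℝ := b * Real.log L with hc_def
  have hc : 0 < c := mul_pos hb hlog
  -- for every s > 0: window bounds with slopes c − s and β' log L + s
  have hboth : ∀ s : ℝ, 0 < s → c - s ≤ binf ∧ binf ≤ β' * Real.log L + s := by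
    intro s hs0
    obtain ⟨γs, hγs, -, hs⟩ := hrem s hs0
    set N₀ : ℕ := ⌈1 / (c * γs ^ 2)⌉₊ with hN₀_def
    have hN₀ : 1 ≤ c * N₀ * γs ^ 2 := by
      have h1 : 1 / (c * γs ^ 2) ≤ N₀ := Nat.le_ceil _
      rw [div_le_iff₀ (by positivity)] at h1
      linarith
    have hwlo : ∀ k n : ℕ, (c - s) * n - R * N₀ ≤ ∑ j ∈ Finset.Ico k (k + n), S.β0 j := by
      intro k n
      obtain ⟨g0, hI, hend, hrg, hbounds⟩ := hK (k + n)
      have hw := beta0_windowSum_ge_of_run S hc hrg hend hg hI hR hs hγs hN₀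
        (fun j hj => by have := (hbounds j hj).1; rw [hc_def]; linarith) (Nat.le_add_right k n)
      have e : (((k + n : ℕ) : ℝ) - k) = n := by push_cast; ring
      rw [e] at hw
      exact hw
    have hwhi : ∀ k n : ℕ, ∑ j ∈ Finset.Ico k (k + n), S.β0 j ≤ (β' * Real.log L + s) * n + R * N₀ := by
      intro k n
      obtain ⟨g0, hI, hend, hrg, hbounds⟩ := hK (k + n)
      have hw := beta0_windowSum_le_of_run S (c' := β' * Real.log L) hc hrg hend hg hI hR hs hγs hN₀
        (fun j hj => by have := (hbounds j hj).1; rw [hc_def]; linarith)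
        (fun j hj => by have := (hbounds j hj).2; linarith) (Nat.le_add_right k n)
      have e : (((k + n : ℕ) : ℝ) - k) = n := by push_cast; ring
      rw [e] at hw
      exact hw
    exact ⟨le_lim_of_windowSum_lower_tendsto hwlo hlim, lim_le_of_windowSum_upper_tendsto hwhi hlim⟩
  refine ⟨le_of_forall_pos_le_add fun s hs => ?_, le_of_forall_pos_le_add fun s hs => ?_⟩
  · have := (hboth s hs).1; linarith
  · exact (hboth s hs).2

/-! ## §3 Packaged over `B12.Thm2Printed` -/

/-- **THEOREM 2 AS PRINTED ⟹ ITS CONSTANTS SANDWICH `β⁰_∞/log L`.**  For a forward-generated construction (halting outside, curried) from a split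
with the every-slope currency and convergent one-loop coefficients `β⁰_{k+1} → β⁰_∞`, and `L > 1`: `B12.Thm2Printed C L` gives, for every torus
exponent `m`, a box size `γ₂ > 0` such that for every `γ ∈ ]0,γ₂]` and every admissible renormalised `g`, (0.31) holds for all lattices with SOME
constants `0 < β ≤ β′` — and EVERY pair `(β, β′)` realising it there for all `K` (with the recursion) satisfies `β·log L ≤ β⁰_∞ ≤ β′·log L`.
[cite: Balaban1987RG1, Thm 2 (0.31) p.259] -/
theorem thm2Printed_constants_sandwich {C : B12.Construction} (hgen : ForwardGenerated C β) (hhalt : HaltsOutside C β)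
    (hcur : CurriesHBeta C β) (S : B12Beta.OneLoopSplit β) {γc binf : ℝ} (hrem : EverySlope S γc)
    (hlim : Tendsto S.β0 atTop (𝓝 binf)) {L : ℝ} (hL : 1 < L) (h : B12.Thm2Printed C L) (m : ℕ) :
    ∃ γ₂ : ℝ, 0 < γ₂ ∧ ∀ γ : ℝ, 0 < γ → γ ≤ γ₂ → ∃ gstar : ℝ, 0 < gstar ∧ ∀ g : ℝ, 0 < g → g ≤ gstar →
      (∃ b β' : ℝ, 0 < b ∧ b ≤ β' ∧ ∀ K : ℕ, ∃ g0 : ℝ,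
        (C ⟨K, m, g0⟩).flow.InInterval γ K ∧ (C ⟨K, m, g0⟩).flow.g K = g ∧ RGEqH K β (C ⟨K, m, g0⟩).flow.g ∧
        ∀ k, k ≤ K →
          1 / g ^ 2 + b * (((K : ℝ) - k) * Real.log L) ≤ 1 / ((C ⟨K, m, g0⟩).flow.g k) ^ 2 ∧
          1 / ((C ⟨K, m, g0⟩).flow.g k) ^ 2 ≤ 1 / g ^ 2 + β' * (((K : ℝ) - k) * Real.log L)) ∧
      ∀ b β' : ℝ, 0 < b → (∀ K : ℕ, ∃ g0 : ℝ,
        (C ⟨K, m, g0⟩).flow.InInterval γ K ∧ (C ⟨K, m, g0⟩).flow.g K = g ∧ RGEqH K β (C ⟨K, m, g0⟩).flow.g ∧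
        ∀ k, k ≤ K →
          1 / g ^ 2 + b * (((K : ℝ) - k) * Real.log L) ≤ 1 / ((C ⟨K, m, g0⟩).flow.g k) ^ 2 ∧
          1 / ((C ⟨K, m, g0⟩).flow.g k) ^ 2 ≤ 1 / g ^ 2 + β' * (((K : ℝ) - k) * Real.log L)) →
        b * Real.log L ≤ binf ∧ binf ≤ β' * Real.log L := by
  obtain ⟨γ₁, hγ₁, -, hR1⟩ := hrem 1 one_pos
  obtain ⟨γ₂, hγ₂, hγ⟩ := runs_of_thm2Printed hgen hhalt hcur h m
  refine ⟨min γ₁ γ₂, lt_min hγ₁ hγ₂, fun γ hγ0 hγle => ?_⟩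
  obtain ⟨gstar, hgstar, hg⟩ := hγ γ hγ0 (hγle.trans (min_le_right _ _))
  have hR : RemainderConst S γ 1 := fun k p hp => hR1 k p fun i => ⟨(hp i).1, (hp i).2.trans (hγle.trans (min_le_left _ _))⟩
  refine ⟨gstar, hgstar, fun g hg0 hgle => ⟨hg g hg0 hgle, fun b β' hb hK => ?_⟩⟩
  exact slope_sandwich_binf_of_runs S hg0 hb hL hR hrem hlim hK

end

end Summit.QuantumFields.BalabanUV.Gaps.CapTailSlopeSandwich
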